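import Literature.GroupTheory.SpecificGroups.GL2IrreducibleUnipotentContainsSL2
import Mathlib.LinearAlgebra.Matrix.Charpoly.Coeff
import Mathlib.LinearAlgebra.Matrix.CharP
import Mathlib.GroupTheory.Perm.Cycle.Type
import Mathlib.Algebra.CharP.Lemmas
import Mathlib.Algebra.Module.ZMod
import Mathlib.LinearAlgebra.Dimension.Free
import Mathlib.LinearAlgebra.Determinant
import Mathlib.LinearAlgebra.Matrix.ToLin
import HarnessLib

/-!
# Serre's Proposition 15: a subgroup of `GL₂(𝔽_l)` of order divisible by `l` is contained in a Borel
# subgroup or contains `SL₂(𝔽_l)`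

J.-P. Serre, *Propriétés galoisiennes des points d'ordre fini des courbes elliptiques*, Invent. Math.
**15** (1972), §2.4, Proposition 15 [cite: Serre1972PointsOrdreFini, §2.4 Prop. 15]:

> Soit `G` un sous-groupe de `GL(V)` (`V` de dimension `2` sur `𝔽_p`) d'ordre divisible par `p`. Alors,
> ou bien `G` est contenu dans un sous-groupe de Borel de `GL(V)`, ou bien `G` contient `SL(V)`.

We prove it in the form: if `l ∣ |H|` and `H` stabilises no line of `𝔽_l²`, then `SL₂(𝔽_l) ≤ H`
(`range_toGL_le_of_dvd_card_of_no_invariant_line`).  By Cauchy's theorem `H` has an element `u` of order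
`l`; in characteristic `l`, `(u − 1)^l = u^l − 1 = 0`, so `N = u − 1` is nilpotent, hence (`2 × 2`,
trace and determinant nilpotent in the field `𝔽_l`) `N² = 0`, and the coordinate-free form of [GenEll]
Lemma 3.1 (iii) (`range_toGL_le_of_unipotent_of_no_invariant_line`, file
`GL2IrreducibleUnipotentContainsSL2.lean`) applies.  This is the form in which the result enters
[GenEll] Thm. 3.8 / [IUTchIV] Cor. 2.2 (P6) (the image of inertia at a prime of multiplicative
reduction with `l ∤` the local height has order divisible by `l`).

Mathlib + the tree only; theorems only; no named facts.
-/

namespace Literature.GroupTheory.SpecificGroups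

open Matrix MatrixGroups

variable {l : ℕ} [Fact l.Prime]

/-- A nilpotent `2 × 2` matrix over a field squares to zero (its trace and determinant are nilpotent,
hence vanish; Cayley–Hamilton in size `2`). [cite: Serre1972PointsOrdreFini, §2.4 Prop. 15] -/
theorem mul_self_eq_zero_of_isNilpotent_fin_two {F : Type*} [Field F] {N : Matrix (Fin 2) (Fin 2) F}
    (hN : IsNilpotent N) : N * N = 0 := by
  have htr : N.trace = 0 := (Matrix.isNilpotent_trace_of_isNilpotent hN).eq_zero
  have hdet : N.det = 0 := by
    obtain ⟨k, hk⟩ := hN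
    have h := congrArg Matrix.det hk
    rw [Matrix.det_pow, Matrix.det_zero] at h
    exact pow_eq_zero_iff (n := k) (by
      rintro rfl
      rw [pow_zero] at hk
      exact one_ne_zero hk) |>.mp h
  rw [Matrix.trace_fin_two] at htr
  rw [Matrix.det_fin_two] at hdet
  ext i j
  fin_cases i <;> fin_cases j <;> simp [Matrix.mul_apply, Fin.sum_univ_two] <;>
    first
      | linear_combination (N 0 0) * htr - hdet
      | linear_combination (N 0 1) * htr
      | linear_combination (N 1 0) * htr
      | linear_combination (N 1 1) * htr - hdet

/-- In `GL₂(𝔽_l)`, an element of order `l` is unipotent: `(u − 1)² = 0`.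
[cite: Serre1972PointsOrdreFini, §2.4 Prop. 15] -/
theorem mul_self_sub_one_eq_zero_of_orderOf_eq {u : GL (Fin 2) (ZMod l)} (hu : orderOf u = l) :
    ((u : Matrix (Fin 2) (Fin 2) (ZMod l)) - 1) * ((u : Matrix (Fin 2) (Fin 2) (ZMod l)) - 1) = 0 := by
  apply mul_self_eq_zero_of_isNilpotent_fin_two
  refine ⟨l, ?_⟩
  have h1 : u ^ orderOf u = 1 := pow_orderOf_eq_one u
  rw [hu] at h1
  have hul : (u : Matrix (Fin 2) (Fin 2) (ZMod l)) ^ l = 1 := by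
    rw [← Units.val_pow_eq_pow_val, h1, Units.val_one]
  rw [sub_pow_char_of_commute l (Commute.one_right _), hul, one_pow, sub_self]

/-- **Serre 1972, Prop. 15** (the dichotomy "Borel or `⊇ SL₂`"), in the form: a subgroup
`H ≤ GL₂(𝔽_l)` (`l` prime) whose order is divisible by `l` and which stabilises no line of `𝔽_l²`
contains `SL₂(𝔽_l)`. [cite: Serre1972PointsOrdreFini, §2.4 Prop. 15] -/
theorem range_toGL_le_of_dvd_card_of_no_invariant_line (H : Subgroup (GL (Fin 2) (ZMod l)))
    (hdiv : l ∣ Nat.card H)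
    (hirr : ∀ v : Fin 2 → ZMod l, v ≠ 0 →
      ∃ h ∈ H, ∀ c : ZMod l, (h : Matrix (Fin 2) (Fin 2) (ZMod l)) *ᵥ v ≠ c • v) :
    (Matrix.SpecialLinearGroup.toGL : SL(2, ZMod l) →* GL (Fin 2) (ZMod l)).range ≤ H := by
  obtain ⟨x, hx⟩ := exists_prime_orderOf_dvd_card' (G := H) l hdiv
  have hu : orderOf (x : GL (Fin 2) (ZMod l)) = l := by rw [Subgroup.orderOf_coe, hx]
  have hu1 : (x : GL (Fin 2) (ZMod l)) ≠ 1 := by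
    intro h1
    have : orderOf (x : GL (Fin 2) (ZMod l)) = 1 := by rw [h1, orderOf_one]
    rw [hu] at this
    exact (Fact.out : l.Prime).one_lt.ne' this
  exact range_toGL_le_of_unipotent_of_no_invariant_line H x.prop hu1
    (mul_self_sub_one_eq_zero_of_orderOf_eq hu) hirr

/-- The same with the order hypothesis phrased as "`H` contains an element of order `l`" (e.g. the image
of an inertia generator acting on the Tate module of a Tate curve).
[cite: Serre1972PointsOrdreFini, §2.4 Prop. 15] -/
theorem range_toGL_le_of_orderOf_eq_of_no_invariant_line (H : Subgroup (GL (Fin 2) (ZMod l)))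
    {u : GL (Fin 2) (ZMod l)} (huH : u ∈ H) (hu : orderOf u = l)
    (hirr : ∀ v : Fin 2 → ZMod l, v ≠ 0 →
      ∃ h ∈ H, ∀ c : ZMod l, (h : Matrix (Fin 2) (Fin 2) (ZMod l)) *ᵥ v ≠ c • v) :
    (Matrix.SpecialLinearGroup.toGL : SL(2, ZMod l) →* GL (Fin 2) (ZMod l)).range ≤ H := by
  have hu1 : u ≠ 1 := by
    intro h1
    have : orderOf u = 1 := by rw [h1, orderOf_one]
    rw [hu] at this
    exact (Fact.out : l.Prime).one_lt.ne' this
  exact range_toGL_le_of_unipotent_of_no_invariant_line H huH hu1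
    (mul_self_sub_one_eq_zero_of_orderOf_eq hu) hirr


/-!
## Part 2 — the basis-free ("Galois-module") form: from a representation on a rank-two `𝔽_l`-module
## to `GL₂(𝔽_l)`; irreducible + an element of order `l` ⇒ the image contains every automorphism of
## determinant one

This is the basis-free ("Galois-module") form of Serre 1972, Prop. 15 / [GenEll] Lemma 3.1 (iii) used
for the mod-`l` representation of an elliptic curve: J.-P. Serre, *Propriétés galoisiennes des points
d'ordre fini des courbes elliptiques*, Invent. Math. 15 (1972), §2.4 Prop. 15 [cite: Serre1972PointsOrdreFini, §2.4 Prop. 15];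
S. Mochizuki, [GenEll] Lemma 3.1 (iii) p. 14 / Thm. 3.8 p. 20 and [IUTchIV] Cor. 2.2 (P6) p. 46 ("the
image of `Gal(Q̄/F) → GL₂(𝔽_l)` determined by the `l`-torsion points … contains `SL₂(𝔽_l)`").

Setting: `A` an additive commutative group which is a `ZMod l`-module with `finrank = 2` (for an
elliptic curve: `A = E[l]`, a `ZMod l`-module through `AddSubgroup.torsionBy.zmodModule`), `G` a group and
`ρ : G →* Multiplicative (AddAut A)` (the shape of the tree's
`WeierstrassCurve.galoisRepTorsion W l : Γ_F →* Multiplicative (AddAut E[l])`, file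
`Literature/NumberTheory/EllipticCurves/GaloisAction.lean`).

* `ofAdd_toAddEquiv_mem_range_of_irreducible_of_orderOf_eq` — if the only `ρ(G)`-stable additive
  subgroups of `A` are `⊥` and `⊤` (the tree's `HasIrreducibleModPGaloisRep` shape; over `𝔽_l` additive
  subgroups are subspaces) and some `ρ g` has order `l`, then for every `ZMod l`-linear automorphism
  `f` of `A` with `LinearMap.det f = 1`, `f ∈ ρ(G)`.
  Proof: choose a basis, transport `ρ(G)` to a subgroup of `GL₂(𝔽_l)` (`LinearMap.toMatrix`); a stable
  line would give a stable subgroup `≠ ⊥, ⊤`; apply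
  `range_toGL_le_of_orderOf_eq_of_no_invariant_line` (Part 1 above).
* `stable_addSubgroup_eq_bot_or_top_of_card` — the dictionary with [GenEll] Lemma 3.5's "`l`-cyclic
  subgroup scheme": if no `ρ(G)`-stable additive subgroup has exactly `l` elements, the representation is
  irreducible in the above sense (a stable subgroup `≠ ⊥, ⊤` of a rank-two `𝔽_l`-space is a line, of
  cardinality `l`).

Mathlib + the tree only; theorems only; no named facts.
-/
open Module

variable {A : Type*} [AddCommGroup A] [Module (ZMod l) A] {G : Type*} [Group G]

/-- **Irreducible + an element of order `l` ⇒ the image contains `SL₂`** (Serre 1972 Prop. 15 /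
[GenEll] Lemma 3.1 (iii) for a rank-two `𝔽_l`-module; the step (P6) of [IUTchIV] Cor. 2.2): every
`ZMod l`-linear automorphism of determinant `1` lies in the image of `ρ`.
[cite: Serre1972PointsOrdreFini, §2.4 Prop. 15] -/
theorem ofAdd_toAddEquiv_mem_range_of_irreducible_of_orderOf_eq (hA : finrank (ZMod l) A = 2)
    (ρ : G →* Multiplicative (AddAut A))
    (hirr : ∀ H : AddSubgroup A, (∀ g : G, ∀ a ∈ H, (ρ g).toAdd a ∈ H) → H = ⊥ ∨ H = ⊤)
    (hord : ∃ g : G, orderOf (ρ g) = l)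
    (f : A ≃ₗ[ZMod l] A) (hf : LinearMap.det (f : A →ₗ[ZMod l] A) = 1) :
    Multiplicative.ofAdd f.toAddEquiv ∈ ρ.range := by
  classical
  haveI : Module.Finite (ZMod l) A := Module.finite_of_finrank_eq_succ hA
  set b : Basis (Fin 2) (ZMod l) A := Module.finBasisOfFinrankEq (ZMod l) A hA with hb
  -- the transport `τ : AddAut A → M₂(𝔽_l) → GL₂(𝔽_l)`
  let lin : Multiplicative (AddAut A) → (A →ₗ[ZMod l] A) := fun e =>
    (Multiplicative.toAdd e).toAddMonoidHom.toZModLinearMap l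
  have lin_apply : ∀ (e : Multiplicative (AddAut A)) (a : A), lin e a = (Multiplicative.toAdd e) a :=
    fun e a => rfl
  let m : Multiplicative (AddAut A) →* Matrix (Fin 2) (Fin 2) (ZMod l) :=
    { toFun := fun e => LinearMap.toMatrix b b (lin e)
      map_one' := by
        have : lin 1 = LinearMap.id := by ext a; rfl
        simp only [this, LinearMap.toMatrix_id]
      map_mul' := fun e e' => by
        have : lin (e * e') = (lin e).comp (lin e') := by ext a; rfl
        simp only [this, LinearMap.toMatrix_comp b b b] }
  have m_apply : ∀ e, m e = LinearMap.toMatrix b b (lin e) := fun e => rfl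
  let τ : Multiplicative (AddAut A) →* GL (Fin 2) (ZMod l) := m.toHomUnits
  have τ_val : ∀ e, ((τ e : GL (Fin 2) (ZMod l)) : Matrix (Fin 2) (Fin 2) (ZMod l)) =
      LinearMap.toMatrix b b (lin e) := fun e => rfl
  -- `τ` is injective
  have lin_inj : Function.Injective lin := by
    intro e e' h
    have h' : ∀ a, (Multiplicative.toAdd e) a = (Multiplicative.toAdd e') a := fun a => by
      rw [← lin_apply, ← lin_apply, h]
    exact Multiplicative.toAdd.injective (AddEquiv.ext h')
  have τ_inj : Function.Injective τ := by
    intro e e' h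
    apply lin_inj
    apply (LinearMap.toMatrix b b).injective
    rw [← τ_val, ← τ_val, h]
  -- the image subgroup in `GL₂(𝔽_l)`
  set H : Subgroup (GL (Fin 2) (ZMod l)) := ρ.range.map τ with hH
  -- an element of order `l`
  obtain ⟨g, hg⟩ := hord
  have huH : τ (ρ g) ∈ H := Subgroup.mem_map_of_mem τ ⟨g, rfl⟩
  have hu : orderOf (τ (ρ g)) = l := by rw [orderOf_injective τ τ_inj, hg]
  -- no invariant line
  have hirr' : ∀ v : Fin 2 → ZMod l, v ≠ 0 →
      ∃ h ∈ H, ∀ c : ZMod l, (h : Matrix (Fin 2) (Fin 2) (ZMod l)) *ᵥ v ≠ c • v := by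
    intro v hv
    by_contra hcon
    push Not at hcon
    -- the vector `a` with coordinates `v` spans a stable line
    set a : A := b.equivFun.symm v with ha
    have hva : b.repr a = Finsupp.equivFunOnFinite.symm v := by
      rw [ha]; simp [Basis.equivFun]
    have hrepr : ∀ i, b.repr a i = v i := fun i => by rw [hva]; rfl
    have ha0 : a ≠ 0 := by
      intro h0
      apply hv
      funext i
      rw [← hrepr i, h0, map_zero, Finsupp.zero_apply, Pi.zero_apply]
    set S : AddSubgroup A := (Submodule.span (ZMod l) {a}).toAddSubgroup with hS
    have hSstab : ∀ g' : G, ∀ x ∈ S, (ρ g').toAdd x ∈ S := by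
      intro g' x hx
      obtain ⟨c, hc⟩ := hcon (τ (ρ g')) (Subgroup.mem_map_of_mem τ ⟨g', rfl⟩)
      -- `(ρ g') a = c • a`
      have hρa : (Multiplicative.toAdd (ρ g')) a = c • a := by
        have h1 : LinearMap.toMatrix b b (lin (ρ g')) *ᵥ (b.repr a) = b.repr (lin (ρ g') a) :=
          LinearMap.toMatrix_mulVec_repr b b (lin (ρ g')) a
        have h2 : (⇑(b.repr a) : Fin 2 → ZMod l) = v := funext hrepr
        rw [h2, ← τ_val, hc] at h1
        -- `b.repr ((ρ g') a) = c • v = b.repr (c • a)`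
        have h3 : b.repr (lin (ρ g') a) = b.repr (c • a) := by
          apply Finsupp.ext
          intro i
          have := congrFun h1 i
          rw [map_smul, Finsupp.smul_apply, hrepr i, smul_eq_mul]
          rw [← this, Pi.smul_apply, smul_eq_mul]
        have h4 := b.repr.injective h3
        rwa [lin_apply] at h4
      rw [hS, Submodule.mem_toAddSubgroup, Submodule.mem_span_singleton] at hx ⊢
      obtain ⟨d, rfl⟩ := hx
      refine ⟨d * c, ?_⟩
      rw [← lin_apply, map_smul, lin_apply, hρa, smul_smul]
    rcases hirr S hSstab with hbot | htop
    · apply ha0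
      have : a ∈ S := by
        rw [hS, Submodule.mem_toAddSubgroup]; exact Submodule.mem_span_singleton_self a
      rw [hbot] at this
      exact (AddSubgroup.mem_bot).mp this
    · -- `span {a} = ⊤` contradicts `finrank = 2`
      have hspan : Submodule.span (ZMod l) ({a} : Set A) = ⊤ := by
        apply Submodule.toAddSubgroup_injective
        rw [← hS, htop, Submodule.top_toAddSubgroup]
      have hle : finrank (ZMod l) A ≤ 1 := by
        rw [← finrank_top, ← hspan]
        exact (finrank_span_le_card ({a} : Set A)).trans (by simp)
      omega
  -- Serre's Prop. 15 in `GL₂(𝔽_l)`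
  have hSL := range_toGL_le_of_orderOf_eq_of_no_invariant_line H huH hu hirr'
  -- the matrix of `f` has determinant one
  have hdetM : Matrix.det (LinearMap.toMatrix b b (f : A →ₗ[ZMod l] A)) = 1 := by
    rw [LinearMap.det_toMatrix, hf]
  obtain ⟨e, he, hτe⟩ := Subgroup.mem_map.mp
    (hSL ⟨⟨LinearMap.toMatrix b b (f : A →ₗ[ZMod l] A), hdetM⟩, rfl⟩)
  -- `τ e = toGL ⟨M_f⟩` forces `e = f`
  have hlin : lin e = (f : A →ₗ[ZMod l] A) := by
    apply (LinearMap.toMatrix b b).injective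
    rw [← τ_val, hτe]
    rfl
  have heq : e = Multiplicative.ofAdd f.toAddEquiv := by
    apply lin_inj
    rw [hlin]
    ext a
    rfl
  rw [← heq]
  exact he

/-- The dictionary with "`l`-cyclic subgroup schemes" ([GenEll] Lemma 3.5 / [IUTchIV] Cor. 2.2 (P4)):
in a rank-two `𝔽_l`-module, if no `ρ(G)`-stable additive subgroup has exactly `l` elements, then every
`ρ(G)`-stable additive subgroup is `⊥` or `⊤`. [cite: MochizukiGenEll2010, Lem 3.5 p.17] -/
theorem stable_addSubgroup_eq_bot_or_top_of_card (hA : finrank (ZMod l) A = 2)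
    (ρ : G →* Multiplicative (AddAut A))
    (hno : ∀ H : AddSubgroup A, (∀ g : G, ∀ a ∈ H, (ρ g).toAdd a ∈ H) → Nat.card H ≠ l)
    (H : AddSubgroup A) (hH : ∀ g : G, ∀ a ∈ H, (ρ g).toAdd a ∈ H) : H = ⊥ ∨ H = ⊤ := by
  classical
  haveI : Module.Finite (ZMod l) A := Module.finite_of_finrank_eq_succ hA
  have hl : l.Prime := Fact.out
  -- `H` is a subspace; its `finrank` is `0`, `1` or `2`
  set S : Submodule (ZMod l) A := AddSubgroup.toZModSubmodule l H with hS
  have hSH : (S : Set A) = H := AddSubgroup.coe_toZModSubmodule l H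
  have hcardS : Nat.card S = l ^ finrank (ZMod l) S := by
    rw [Module.natCard_eq_pow_finrank (K := ZMod l) (V := S), Nat.card_zmod]
  have hle : finrank (ZMod l) S ≤ 2 := hA ▸ Submodule.finrank_le S
  have hcardH : Nat.card H = Nat.card S := by
    rw [← SetLike.coe_sort_coe H, ← SetLike.coe_sort_coe S, hSH]
  interval_cases hfr : finrank (ZMod l) S
  · left
    have : S = ⊥ := Submodule.finrank_eq_zero.mp hfr
    apply le_antisymm _ bot_le
    intro x hx
    have hx' : x ∈ S := by rw [← SetLike.mem_coe, hSH]; exact hx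
    rw [this] at hx'
    exact (Submodule.mem_bot (R := ZMod l)).mp hx'
  · exfalso
    apply hno H hH
    rw [hcardH, hcardS, pow_one]
  · right
    have : S = ⊤ := Submodule.eq_top_of_finrank_eq (by rw [hfr, hA])
    apply le_antisymm le_top
    intro x _
    have hx' : x ∈ S := by rw [this]; exact Submodule.mem_top
    rwa [← SetLike.mem_coe, hSH] at hx'

end Literature.GroupTheory.SpecificGroups
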